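import Mathlib
import Literature.Algebra.Polynomial.NewtonPolytope
import Literature.Barriers.PneNP.TSPExtensionComplexity
import Literature.Barriers.PneNP.ExtendedFormulationCalculus
import Literature.Barriers.ValiantsHypothesis.MonotoneGapParseTrees
import Literature.Computability.AlgebraicComplexity.FormulaUnfolding
import Literature.Computability.AlgebraicComplexity.MonotoneNewtonPolytopeXC
import HarnessLib

/-!
# Hrubeš–Yehudayoff 2021, Theorem 35 — proof (`HrubesYehudayoff.theorem35_holds`)

Discharges the named fact `Literature.Computability.AlgebraicComplexity.HrubesYehudayoff.theorem35`
(`MonotoneNewtonPolytopeXC.lean`): a polynomial over `ℝ≥0` computed by a monotone fan-in-two formula with at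
most `s` gates has a Newton polytope with a slack-form extended formulation of size `2·(s+1)` (so `C = 2`).
Source: P. Hrubeš, A. Yehudayoff, *Shadows of Newton polytopes*, CCC 2021, §5.4 (held text
`paper:url-d136d073b26d` p0014 L26–31): Lemma 34 (`xc(P + Q) ≤ xc P + xc Q`, `xc(P ⊔ Q) ≤ xc P + xc Q + 2`)
and "The lower bound is now proved by a straightforward induction. ▶ Theorem 35."

The induction, as formalised: (1) the formula is unfolded to a weighted binary expression with at most as many
nodes as the formula has gates and the same value (the tree's `ArithCircuit.toWExpr`, `ArithCircuit.eval_toWExpr`,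
`ArithCircuit.size_toWExpr_le` of `FormulaUnfolding.lean`); (2) by structural induction every node's value `g`
has a POINTED extended formulation (`Literature.Barriers.PneNP.HasPointedEFOfSize`, `ExtendedFormulationCalculus.lean`)
of `Newt(g)` of size `≤ 2 · #nodes`: leaves `X_i`, `c` give a point or `∅` (size `0`); a weighted-sum node
`c₁ g₁ + c₂ g₂` has `Newt = conv(Newt(c₁ g₁) ∪ Newt(c₂ g₂))` because coefficients in `ℝ≥0` do not cancel
(`newtonPolytope_map_add`, via the tree's `JerrumSnir.support_add_eq` / `support_smul_eq` of
`MonotoneGapParseTrees.lean`), and `Newt(c g) ∈ {Newt g, ∅}`, so Balas' bound `r₁ + r₂ + 2`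
(`HasPointedEFOfSize.convexHull_union`) applies; a product node has `Newt(g₁ g₂) = Newt g₁ + Newt g₂`
(`newtonPolytope_mul`) and costs `r₁ + r₂` (`HasPointedEFOfSize.add`); (3) pointed formulations are slack-form
EFs (`HasPointedEFOfSize.hasEFOfSize`).  Honest framing: a Literature discharge; nothing here bears on
`VP ≠ VNP` (NOT proved). [cite: HrubesYehudayoff2021, Theorem 35]
-/

noncomputable section

namespace Literature.Computability.AlgebraicComplexity.HrubesYehudayoff

open scoped NNReal Pointwise
open MvPolynomial Literature.Algebra.Polynomial.NewtonPolytope Literature.Barriers.PneNP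

/-! ### Degenerate polytopes: `∅` and points cost `0` -/

/-- The empty set has a pointed formulation of size `0` (no variables, the infeasible equation `0 = 1`);
needed for `Newt(0) = ∅`. [cite: HrubesYehudayoff2021, Lemma 34] -/
theorem hasPointedEFOfSize_empty {ι : Type} : HasPointedEFOfSize (∅ : Set (ι → ℝ)) 0 := by
  refine ⟨Fin 0, Unit, inferInstance, inferInstance, 0, 0, 0, fun _ => 1, by simp, fun y _ _ => by simp, ?_⟩
  ext x
  simp only [pointedSet, Set.mem_empty_iff_false, Set.mem_setOf_eq, false_iff, not_exists, not_and]
  intro y _ hB _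
  have := congrFun hB ()
  simp [Matrix.zero_mulVec] at this

/-- The convex hull of a set with at most one point (`∅` or a point) has a pointed formulation of size `0`.
[cite: HrubesYehudayoff2021, Lemma 34] -/
theorem hasPointedEFOfSize_convexHull_of_subset_singleton {ι : Type} {S : Set (ι → ℝ)} {p : ι → ℝ}
    (h : S ⊆ {p}) : HasPointedEFOfSize (convexHull ℝ S) 0 := by
  rcases Set.subset_singleton_iff_eq.1 h with rfl | rfl
  · rw [convexHull_empty]
    exact hasPointedEFOfSize_empty
  · rw [convexHull_singleton]
    exact hasPointedEFOfSize_singleton p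

/-! ### Newton polytopes of polynomials with nonnegative coefficients -/

variable {σ : Type}

/-- The Newton polytope of the real lift of `g ∈ ℝ≥0[x]` is the convex hull of the exponents of `g` (the lift
preserves supports). [cite: HrubesYehudayoff2021, §5.4] -/
theorem newtonPolytope_map_eq (g : MvPolynomial σ ℝ≥0) :
    newtonPolytope (map NNReal.toRealHom g) =
      convexHull ℝ (exponentPt ℝ '' (g.support : Set (σ →₀ ℕ))) := by
  rw [newtonPolytope_def, support_map_of_injective g (f := NNReal.toRealHom)
    (fun a b h => NNReal.coe_injective h)]

/-- **`Newt(g₁ + g₂) = conv(Newt g₁ ∪ Newt g₂)` for `g₁, g₂` with nonnegative coefficients.**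
[cite: HrubesYehudayoff2021, §5.4] -/
theorem newtonPolytope_map_add [DecidableEq σ] (g₁ g₂ : MvPolynomial σ ℝ≥0) :
    newtonPolytope (map NNReal.toRealHom (g₁ + g₂)) =
      convexHull ℝ (newtonPolytope (map NNReal.toRealHom g₁) ∪ newtonPolytope (map NNReal.toRealHom g₂)) := by
  rw [newtonPolytope_map_eq, newtonPolytope_map_eq, newtonPolytope_map_eq,
    Literature.Barriers.ValiantsHypothesis.JerrumSnir.support_add_eq,
    Finset.coe_union, Set.image_union, convexHull_convexHull_union_left,
    convexHull_convexHull_union_right]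

/-- `Newt(c g) = Newt g` for `c ≠ 0`. [cite: HrubesYehudayoff2021, §5.4] -/
theorem newtonPolytope_map_smul [DecidableEq σ] {c : ℝ≥0} (hc : c ≠ 0) (g : MvPolynomial σ ℝ≥0) :
    newtonPolytope (map NNReal.toRealHom (c • g)) = newtonPolytope (map NNReal.toRealHom g) := by
  rw [newtonPolytope_map_eq, newtonPolytope_map_eq,
    Literature.Barriers.ValiantsHypothesis.JerrumSnir.support_smul_eq hc]

/-- A pointed formulation of `Newt g` gives one of `Newt(c g)` of at most the same size (`Newt(0) = ∅` costs
`0`). [cite: HrubesYehudayoff2021, Lemma 34] -/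
theorem hasPointedEFOfSize_smul [DecidableEq σ] (c : ℝ≥0) (g : MvPolynomial σ ℝ≥0) {r : ℕ}
    (h : HasPointedEFOfSize (newtonPolytope (map NNReal.toRealHom g)) r) :
    ∃ r', r' ≤ r ∧ HasPointedEFOfSize (newtonPolytope (map NNReal.toRealHom (c • g))) r' := by
  by_cases hc : c = 0
  · refine ⟨0, Nat.zero_le _, ?_⟩
    rw [hc, zero_smul, map_zero, newtonPolytope_zero]
    exact hasPointedEFOfSize_empty
  · exact ⟨r, le_rfl, by rwa [newtonPolytope_map_smul hc]⟩

/-! ### The induction over the unfolded formula -/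

/-- **Every node of a weighted binary expression over `ℝ≥0` has a pointed formulation of its Newton polytope
of size at most twice its number of nodes** (leaves: a point or `∅`, size `0`; `lin`: Balas, `+2`; `mul`:
Minkowski, `+0`). [cite: HrubesYehudayoff2021, Theorem 35 (proof)] -/
theorem exists_hasPointedEFOfSize_wexpr [Fintype σ] [DecidableEq σ] (e : WExpr ℝ≥0 σ) :
    ∃ r, r ≤ 2 * e.size ∧ HasPointedEFOfSize (newtonPolytope (map NNReal.toRealHom e.eval)) r := by
  induction e with
  | var i =>
    refine ⟨0, Nat.zero_le _, ?_⟩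
    rw [WExpr.eval_var, newtonPolytope_map_eq]
    refine hasPointedEFOfSize_convexHull_of_subset_singleton (p := exponentPt ℝ (Finsupp.single i 1)) ?_
    rw [support_X, Finset.coe_singleton, Set.image_singleton]
  | const c =>
    refine ⟨0, Nat.zero_le _, ?_⟩
    rw [WExpr.eval_const, newtonPolytope_map_eq]
    refine hasPointedEFOfSize_convexHull_of_subset_singleton (p := exponentPt ℝ (0 : σ →₀ ℕ)) ?_
    have hsub : ((C c : MvPolynomial σ ℝ≥0).support : Set (σ →₀ ℕ)) ⊆ {0} := by
      rw [← Finset.coe_singleton]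
      exact Finset.coe_subset.2 (by rw [C_apply]; exact support_monomial_subset)
    refine (Set.image_mono hsub).trans ?_
    rw [Set.image_singleton]
  | lin c₁ e₁ c₂ e₂ ih₁ ih₂ =>
    obtain ⟨r₁, hr₁, h₁⟩ := ih₁
    obtain ⟨r₂, hr₂, h₂⟩ := ih₂
    obtain ⟨r₁', hr₁', h₁'⟩ := hasPointedEFOfSize_smul c₁ _ h₁
    obtain ⟨r₂', hr₂', h₂'⟩ := hasPointedEFOfSize_smul c₂ _ h₂
    refine ⟨r₁' + r₂' + 2, ?_, ?_⟩
    · simp only [WExpr.size]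
      omega
    · rw [WExpr.eval_lin, newtonPolytope_map_add]
      exact h₁'.convexHull_union h₂'
  | mul e₁ e₂ ih₁ ih₂ =>
    obtain ⟨r₁, hr₁, h₁⟩ := ih₁
    obtain ⟨r₂, hr₂, h₂⟩ := ih₂
    refine ⟨r₁ + r₂, ?_, ?_⟩
    · simp only [WExpr.size]
      omega
    · rw [WExpr.eval_mul, map_mul, newtonPolytope_mul]
      exact h₁.add h₂

/-- **Hrubeš–Yehudayoff 2021, Theorem 35, proved** (with `C = 2`): a polynomial over `ℝ≥0` computed by a
monotone fan-in-two formula with at most `s` gates has `xc(Newt f) ≤ 2 (s + 1)` in the tree's slack-form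
sense.  Unfold the formula (`ArithCircuit.size_toWExpr_le`, `ArithCircuit.eval_toWExpr`), run
`exists_hasPointedEFOfSize_wexpr`, and pass to slack form. [cite: HrubesYehudayoff2021, Theorem 35] -/
theorem theorem35_holds : theorem35 := by
  refine ⟨2, fun n s f P hF h2 hC hs => ?_⟩
  obtain ⟨r, hr, hP⟩ := exists_hasPointedEFOfSize_wexpr P.toWExpr
  have heval : P.toWExpr.eval = f := by
    rw [ArithCircuit.eval_toWExpr]
    exact hC
  have hsize : P.toWExpr.size ≤ P.size := ArithCircuit.size_toWExpr_le hF h2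
  rw [heval] at hP
  exact hP.hasEFOfSize.of_le (by omega)

/-- **Theorem 35 in the tree's complexity measure**: over `ℝ≥0` the fan-in-two formula complexity
`formulaComplexity f` (`CircuitDepth.lean`) IS the monotone formula complexity of `f`, and
`xc(Newt f) ≤ 2 · formulaComplexity f` in the slack-form sense (unfold an optimal formula,
`exists_wexpr_size_le_formulaComplexity`). [cite: HrubesYehudayoff2021, Theorem 35] -/
theorem hasEFOfSize_newtonPolytope_formulaComplexity [Fintype σ] [DecidableEq σ]
    (f : MvPolynomial σ ℝ≥0) :
    HasEFOfSize (newtonPolytope (map NNReal.toRealHom f)) (2 * formulaComplexity f) := by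
  obtain ⟨e, he, hs⟩ := exists_wexpr_size_le_formulaComplexity f
  obtain ⟨r, hr, hP⟩ := exists_hasPointedEFOfSize_wexpr e
  rw [he] at hP
  exact hP.hasEFOfSize.of_le (by omega)

end Literature.Computability.AlgebraicComplexity.HrubesYehudayoff

end
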